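import Literature.AnabelianGeometry.AbsoluteAnabelian.ProfiniteElasticAscent
import HarnessLib

/-!
# Slimness ASCENDS from an open slim subgroup of a compact group without finite normal subgroups ([AbsTopI] §0)

S. Mochizuki, *Topics in Absolute Anabelian Geometry I: Generalities* (2012) [AbsTopI] (lit key
`paper:url-11ac98ba15fc`), §0 "Topological Groups" p. 8: "We shall say that a profinite group `G` is slim if for
every open subgroup `H ⊆ G`, the centralizer `Z_G(H)` is trivial.  Note that every finite normal closed subgroup
`N ⊆ G` of a slim profinite group `G` is trivial."  The tree proves the quoted remark
(`eq_bot_of_finite_normal_of_isSlimGroup`, `SlimFiniteNormalProofs.lean`) and the DESCENT of slimness to open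
subgroups (`isSlimGroup_subgroup_of_isOpen`).  This PROOF-ONLY file (no definition, no named fact) proves the ASCENT
in the converse direction, under exactly the necessary condition of the remark:

* `isSlimGroup_of_isOpen_slim_of_forall_finite_normal_eq_bot` — **if `G` is a compact topological group, `U ⊆ G` an
  OPEN subgroup which is slim, and `G` has no nontrivial finite normal subgroup, then `G` is slim.**  Proof
  (abc-iut-L4-lead RULING #6t sketch, made precise): for an open `V ⊆ G` put `W := normalCore (V ∩ U)` — normal,
  contained in `V`, and OPEN (`V ∩ U` has finite index in the compact `G`, so its normal core has finite
  index and is closed, hence open).  The centraliser `Z := Z_G(W)` is then NORMAL in `G` (`W` normal), and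
  `Z ∩ U ⊆ Z_U(W) = 1` since `W` is open in the slim group `U`; so `Z` injects into the finite coset space `G/U`
  (`finite_of_inf_eq_bot_of_isOpen`), is a finite normal subgroup, and is trivial by hypothesis; finally
  `Z_G(V) ⊆ Z_G(W) = 1`.
* `isSlimGroup_iff_of_isOpen_of_forall_finite_normal_eq_bot` — with [AbsTopI] §0: for compact Hausdorff `G` without
  nontrivial finite normal subgroups and `U ⊆ G` open, `G` slim ↔ `U` slim.
* `slim_and_elastic_of_isOpen` — combined with `ProfiniteElasticAscent.lean` (p432240): `U` open, slim AND elastic,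
  and `G` compact Hausdorff without nontrivial finite normal subgroups ⇒ `G` slim and elastic; packaged for the typed
  node predicate as `FundamentalExtension.geomSlimElastic_of_isOpen_slim_elastic`.

The hypothesis «no nontrivial finite normal subgroup» is NECESSARY and not removable by group theory (`U × F`, `F`
finite nontrivial, has the open slim subgroup `U` and is not slim); for print's almost pro-`Σ` GFG-type groups
`Δ_X` ([AbsTopI] Def 2.1 (i), Prop 2.3 (i)) it is a genuinely geometric input.  USE: node AbsTopI:Prop2.3(i) — with
this file and p432240, "`Δ` is slim and elastic" for an almost pro-`Σ` `Δ ⊇ Δ'` (`Δ'` = open pro-`Σ` surface-group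
subgroup, slim and elastic by the surface-group model p424056/p424779) reduces to the single input «`Δ` has no
nontrivial finite normal subgroup».  Classical; OUR kernel check; nothing here bears on [IUTchIII] Cor. 3.12.
-/

noncomputable section

open Topology

universe u

namespace Literature.AnabelianGeometry.AbsoluteAnabelian

open Literature.AlgebraicGeometry.Frobenioids (IsSlimGroup)

variable {G : Type u} [Group G] [TopologicalSpace G] [IsTopologicalGroup G]

/-- In a compact group, the normal core of an OPEN subgroup is open (finite index, and closed by Mathlib's
`Subgroup.normalCore_isClosed`).  (Same content as the tree's `isOpen_normalCore` for `OpenSubgroup`s in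
`GaloisCyclotomeMLFReduction.lean`; a private copy on bare subgroups keeps this file's imports elementary.)
[cite: MochizukiAbsTopI2012, §0 p.8] -/
private theorem isOpen_normalCore_aux [CompactSpace G] (H : Subgroup G) (hH : IsOpen (H : Set G)) :
    IsOpen (H.normalCore : Set G) := by
  haveI : Finite (G ⧸ H) := Subgroup.quotient_finite_of_isOpen H hH
  haveI : H.FiniteIndex := Subgroup.finiteIndex_of_finite_quotient
  haveI : H.normalCore.FiniteIndex := Subgroup.finiteIndex_normalCore H
  exact Subgroup.isOpen_of_isClosed_of_finiteIndex _
    (H.normalCore_isClosed (Subgroup.isClosed_of_isOpen H hH))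

omit [TopologicalSpace G] [IsTopologicalGroup G] in
/-- The centraliser of a normal subgroup is normal. [cite: MochizukiAbsTopI2012, §0 p.8] -/
theorem centralizer_normal_of_normal (W : Subgroup G) [hW : W.Normal] :
    (Subgroup.centralizer (W : Set G)).Normal := by
  refine ⟨fun z hz g => ?_⟩
  rw [Subgroup.mem_centralizer_iff] at hz ⊢
  intro w hw
  have hw' : g⁻¹ * w * g ∈ W := by
    have := hW.conj_mem w hw g⁻¹
    simpa using this
  have key := hz _ hw'
  -- `w * (g z g⁻¹) = g ((g⁻¹ w g) z) g⁻¹ = g (z (g⁻¹ w g)) g⁻¹ = (g z g⁻¹) * w`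
  calc w * (g * z * g⁻¹) = g * ((g⁻¹ * w * g) * z) * g⁻¹ := by group
    _ = g * (z * (g⁻¹ * w * g)) * g⁻¹ := by rw [key]
    _ = g * z * g⁻¹ * w := by group

omit [IsTopologicalGroup G] in
/-- For `W` open in `G` and `U` slim: the centraliser of `W` in `G` meets `U` trivially (its trace on `U`
centralises the open subgroup `W ∩ U` of `U`). [cite: MochizukiAbsTopI2012, §0 p.8] -/
theorem centralizer_inf_eq_bot_of_slim (U W : Subgroup G) (hU : IsSlimGroup U)
    (hWo : IsOpen (W : Set G)) : Subgroup.centralizer (W : Set G) ⊓ U = ⊥ := by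
  -- `W` as an open subgroup of `U`
  have hWUo : IsOpen ((W.subgroupOf U : Subgroup U) : Set U) := by
    rw [Subgroup.coe_subgroupOf]
    exact hWo.preimage continuous_subtype_val
  have hc := hU.centralizer_eq_bot _ hWUo
  rw [eq_bot_iff]
  intro z hz'
  obtain ⟨hz, hzU⟩ := Subgroup.mem_inf.mp hz'
  rw [Subgroup.mem_centralizer_iff] at hz
  have hmem : (⟨z, hzU⟩ : U) ∈ Subgroup.centralizer ((W.subgroupOf U : Subgroup U) : Set U) := by
    rw [Subgroup.mem_centralizer_iff]
    intro w hw
    rw [SetLike.mem_coe, Subgroup.mem_subgroupOf] at hw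
    exact Subtype.ext (hz _ hw)
  rw [hc, Subgroup.mem_bot] at hmem
  exact Subgroup.mem_bot.mpr (congrArg Subtype.val hmem)

/-- **Slimness ascends from an open slim subgroup of a compact group with no nontrivial finite normal subgroup**
([AbsTopI] §0; RULING #6t of the abc-iut L4 board): `U ⊆ G` open and slim, every finite normal subgroup of `G`
trivial ⇒ `G` slim. [cite: MochizukiAbsTopI2012, §0 p.8] -/
theorem isSlimGroup_of_isOpen_slim_of_forall_finite_normal_eq_bot [CompactSpace G] (U : Subgroup G)
    (hUo : IsOpen (U : Set G)) (hU : IsSlimGroup U)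
    (hfin : ∀ N : Subgroup G, N.Normal → (N : Set G).Finite → N = ⊥) : IsSlimGroup G := by
  refine ⟨fun V hVo => ?_⟩
  -- the open normal subgroup `W := core(V ∩ U) ⊆ U`
  let W : Subgroup G := (V ⊓ U).normalCore
  have hWo : IsOpen (W : Set G) := isOpen_normalCore_aux _ (hVo.inter hUo)
  have hWV : (W : Set G) ⊆ (V : Set G) := fun x hx => (le_trans (Subgroup.normalCore_le _) inf_le_left) hx
  haveI : W.Normal := Subgroup.normalCore_normal _
  -- its centraliser is a finite normal subgroup, hence trivial
  haveI hZn : (Subgroup.centralizer (W : Set G)).Normal := centralizer_normal_of_normal W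
  have hZfin : ((Subgroup.centralizer (W : Set G) : Subgroup G) : Set G).Finite :=
    finite_of_inf_eq_bot_of_isOpen _ U hUo (centralizer_inf_eq_bot_of_slim U W hU hWo)
  have hZ : Subgroup.centralizer (W : Set G) = ⊥ := hfin _ hZn hZfin
  -- `Z_G(V) ⊆ Z_G(W) = 1`
  rw [eq_bot_iff, ← hZ]
  exact Subgroup.centralizer_le hWV

/-- For a compact Hausdorff group with no nontrivial finite normal subgroup and an open subgroup `U`: `G` is slim iff
`U` is (descent: any open subgroup of a slim group is slim; ascent: the previous theorem).
[cite: MochizukiAbsTopI2012, §0 p.8] -/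
theorem isSlimGroup_iff_of_isOpen_of_forall_finite_normal_eq_bot [CompactSpace G] (U : Subgroup G)
    (hUo : IsOpen (U : Set G)) (hfin : ∀ N : Subgroup G, N.Normal → (N : Set G).Finite → N = ⊥) :
    IsSlimGroup G ↔ IsSlimGroup U := by
  refine ⟨fun hG => ?_, fun hU => isSlimGroup_of_isOpen_slim_of_forall_finite_normal_eq_bot U hUo hU hfin⟩
  -- descent (re-derived: an open subgroup of the open `U` is open in `G`)
  refine ⟨fun V hV => ?_⟩
  have hVo : IsOpen ((V.map U.subtype : Subgroup G) : Set G) := by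
    have : ((V.map U.subtype : Subgroup G) : Set G) = Subtype.val '' (V : Set U) := by
      ext x; simp
    rw [this]
    exact hUo.isOpenMap_subtype_val _ hV
  have hc := hG.centralizer_eq_bot _ hVo
  refine (Subgroup.eq_bot_iff_forall _).mpr fun c hc' => ?_
  have hcG : (c : G) ∈ Subgroup.centralizer ((V.map U.subtype : Subgroup G) : Set G) := by
    rw [Subgroup.mem_centralizer_iff]
    rintro _ ⟨v, hv, rfl⟩
    exact congrArg Subtype.val (Subgroup.mem_centralizer_iff.mp hc' v hv)
  rw [hc] at hcG
  exact Subtype.ext (Subgroup.mem_bot.mp hcG)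

/-- **Slim AND elastic ascend together**: `U ⊆ G` open, slim and elastic, `G` compact Hausdorff with no nontrivial
finite normal subgroup ⇒ `G` slim and elastic (slimness by this file, elasticity by `ProfiniteElasticAscent.lean`).
[cite: MochizukiAbsTopI2012, Def 1.1 (ii) p.10] -/
theorem slim_and_elastic_of_isOpen [CompactSpace G] [T2Space G] (U : Subgroup G) (hUo : IsOpen (U : Set G))
    (hUs : IsSlimGroup U) (hUe : IsElastic U)
    (hfin : ∀ N : Subgroup G, N.Normal → (N : Set G).Finite → N = ⊥) : IsSlimGroup G ∧ IsElastic G :=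
  have hG := isSlimGroup_of_isOpen_slim_of_forall_finite_normal_eq_bot U hUo hUs hfin
  ⟨hG, isElastic_of_isSlimGroup_of_isOpen_of_isElastic hG U hUo hUe⟩

namespace FundamentalExtension

/-- Packaged for the node predicate of [AbsTopI] Prop 2.3 (i): if `Δ = E.geom` has no nontrivial finite normal
subgroup and admits an OPEN subgroup that is slim and elastic (e.g. the pro-`Σ` fundamental group of a finite étale
covering `Y → X` inside an almost pro-`Σ` GFG-type group, slim and elastic by the surface-group model), then
`E.GeomSlimElastic`. [cite: MochizukiAbsTopI2012, Prop 2.3 (i) p.19] -/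
theorem geomSlimElastic_of_isOpen_slim_elastic (E : FundamentalExtension.{u}) (U : Subgroup E.geom)
    (hUo : IsOpen (U : Set E.geom)) (hUs : IsSlimGroup U) (hUe : IsElastic U)
    (hfin : ∀ N : Subgroup E.geom, N.Normal → (N : Set E.geom).Finite → N = ⊥) : E.GeomSlimElastic := by
  haveI : CompactSpace E.geom := isCompact_iff_compactSpace.mp E.isClosed_geom.isCompact
  exact slim_and_elastic_of_isOpen U hUo hUs hUe hfin

end FundamentalExtension

end Literature.AnabelianGeometry.AbsoluteAnabelian

end
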